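import Mathlib
import Summits.ResolutionOfSingularities.ResolutionOfSingularities.Theorems.WildQuotientsKiralyLutkebohmertPseudoreflection
import Summits.ResolutionOfSingularities.ResolutionOfSingularities.Theorems.WildQuotientsKiralyLutkebohmertConjectureNineTwo
import Summits.ResolutionOfSingularities.ResolutionOfSingularities.Theorems.WildQuotientsKiralyLutkebohmertRank
import Summits.ResolutionOfSingularities.ResolutionOfSingularities.Theorems.WildQuotientsKiralyLutkebohmertFixedLocal
import Summits.ResolutionOfSingularities.ResolutionOfSingularities.Theorems.WildQuotientsKiralyLutkebohmertTypeOneFiber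
import HarnessLib

/-!
# Király–Lütkebohmert (ANT 7 (2013)), §3: Conjecture 9 holds for `p = 3` in the residue-trivial case

Route `ResolutionOfSingularities/WildQuotients`; helper toward the depth-0 / kill-criterion dictionary
of the crux `CyclicQuotientFourfolds` (stmt-ResolutionOfSingularities-17941, research stub
`stub_reachLowerInFX`; memo `KL-CONJ9-STATUS.md`, item 1). F. Király, W. Lütkebohmert, *Group actions
of prime order on local normal rings*, ANT 7 (2013) 63–74, §3: «In higher dimension, the converse
(2) ⇒ (1) is uncertain, but it holds for small primes `p ≤ 3` as we explain now.» (pp. 70–71).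

This file proves the case `p = 3` when the fixed ring has the same residue field as `B`
(`∀ b, ∃ a, σ a = a ∧ b − a ∈ 𝔪_B` — the case of a closed fixed point over an algebraically closed
field, and the first of the two printed sub-cases). The printed proof counts lengths
(`ℓ(B/𝔪_B⁴) = 10 ≠ 9`) after an induction on `dim A`; we use instead the induction-free invariant
`dim_k Soc(B/𝔪_A B) = 1` (`kl_finrank_socle_fiber_eq_one`, Bruns–Herzog 1.2.19): with
`B = A ⊕ Au ⊕ Av` (`kl_nonempty_basis_fin_of_free`, rank `3`, and the unit trick) and `u, v ∈ 𝔪_B`,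
an elementary case analysis on `u², v², uv mod 𝔪_A B` shows that `𝔪_B = wB + 𝔪_A B` for `w = u`
or `w = v` — the only non-trivial case `u², uv, v² ∈ 𝔪_A B` puts `ū, v̄` in the socle, where they
must be DEPENDENT — so `σ` is a pseudoreflection and `kl_augIdeal_eq_span_singleton_of_pseudoreflection`
(Thm. 2 (e) ⇒ (a)) gives a principal augmentation ideal.

* `kl_exists_gen_le_span_sup_of_socle` — the elementary case analysis (any local ring).
* `kl_socle_pair_dependent` — two socle elements of a module whose socle has `k`-dimension `1` are
  dependent with a unit coefficient.
* `kl_exists_two_generators_of_basis_three` — unit trick: an `A`-basis of size `3` of the local ring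
  `B` over `A = B^σ` with `k_A = k_B` gives `B = A + Au + Av` with `u, v ∈ 𝔪_B`.
* `kl_conjecture9_three_of_residue` — **Conjecture 9 for `p = 3`, residue-trivial case**.
  [cite: KiralyLutkebohmert2013, §3 Conjecture 9 (case p = 3), pp. 70–71]

[OURS · crux stmt-ResolutionOfSingularities-17941 · helper (def-free); printed statement of
KiralyLutkebohmert2013 §3 (sub-case `k_A = k_B`), different proof; counted 0; AI-level work, weaker
than expert review.]
-/

-- single-problem summit: the doubled namespace component `ResolutionOfSingularities` is forced
set_option linter.dupNamespace false

open IsLocalRing Submodule Literature.AlgebraicGeometry.Resolution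

namespace Summit.ResolutionOfSingularities.ResolutionOfSingularities.Theorems

universe u

section Elementary

variable {B : Type*} [CommRing B] [IsLocalRing B]

/-- **The case analysis** (any local ring `B`): let `A ⊆ B` be a subring with `A ∩ 𝔪_B ⊆ J` for an
ideal `J`, `u, v ∈ 𝔪_B` with `B = A + Au + Av`, and suppose any two elements `s, t` with
`𝔪_B s, 𝔪_B t ⊆ J` satisfy a relation `c₁ s + c₂ t ∈ J` with `c₁` or `c₂` a unit. Then
`𝔪_B ⊆ wB + J` for `w = u` or `w = v` (cases: `u² ∉ J`; `v² ∉ J`; `u², v² ∈ J`, where `uv ∈ J` is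
forced and `ū, v̄` lie in the socle). [folklore; replaces KiralyLutkebohmert2013 §3's length count] -/
theorem kl_exists_gen_le_span_sup_of_socle (A : Subring B) (J : Ideal B)
    (hAJ : ∀ a : A, (a : B) ∈ maximalIdeal B → (a : B) ∈ J)
    (u v : B) (hu : u ∈ maximalIdeal B) (hv : v ∈ maximalIdeal B)
    (hgen : ∀ b : B, ∃ a a₁ a₂ : A, b = a + a₁ * u + a₂ * v)
    (hsoc : ∀ s t : B, (∀ c ∈ maximalIdeal B, c * s ∈ J) → (∀ c ∈ maximalIdeal B, c * t ∈ J) →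
      ∃ c₁ c₂ : B, (c₁ ∉ maximalIdeal B ∨ c₂ ∉ maximalIdeal B) ∧ c₁ * s + c₂ * t ∈ J) :
    ∃ w : B, (w = u ∨ w = v) ∧ maximalIdeal B ≤ Ideal.span {w} ⊔ J := by
  classical
  have hunit : ∀ x : B, x ∉ maximalIdeal B → IsUnit x := fun x hx => by
    by_contra h
    exact hx ((mem_maximalIdeal _).mpr h)
  have hAJ' : ∀ a : A, ¬ IsUnit (a : B) → (a : B) ∈ J := fun a ha =>
    hAJ a ((mem_maximalIdeal _).mpr ha)
  have cancel : ∀ (I : Ideal B) (x y : B), IsUnit x → x * y ∈ I → y ∈ I := by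
    intro I x y hx h
    obtain ⟨b, hb⟩ := hx.exists_left_inv
    have := I.mul_mem_left b h
    rwa [← mul_assoc, hb, one_mul] at this
  have hunit_sub : ∀ x y : B, IsUnit x → y ∈ maximalIdeal B → IsUnit (y - x) := by
    intro x y hx hy
    by_contra h
    have h1 : y - x ∈ maximalIdeal B := (mem_maximalIdeal _).mpr h
    have h2 : x ∈ maximalIdeal B := by
      have := sub_mem hy h1
      rwa [sub_sub_cancel] at this
    exact ((mem_maximalIdeal _).mp h2) hx
  -- the constant coefficient of an element of `𝔪_B` lies in `J`
  have hconst : ∀ (x y : B), x ∈ maximalIdeal B → y ∈ maximalIdeal B →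
      ∀ (b : B) (a a₁ a₂ : A), b ∈ maximalIdeal B → b = a + a₁ * x + a₂ * y → (a : B) ∈ J := by
    intro x y hx hy b a a₁ a₂ hb he
    apply hAJ
    have : (a : B) = b - a₁ * x - a₂ * y := by rw [he]; ring
    rw [this]
    exact sub_mem (sub_mem hb (Ideal.mul_mem_left _ _ hx)) (Ideal.mul_mem_left _ _ hy)
  -- case `x² ∉ J`: `y ∈ xB + J`
  have sq_case : ∀ x y : B, x ∈ maximalIdeal B → y ∈ maximalIdeal B →
      (∀ b : B, ∃ a a₁ a₂ : A, b = a + a₁ * x + a₂ * y) → x * x ∉ J →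
      y ∈ Ideal.span {x} ⊔ J := by
    intro x y hx hy hrep hx2
    obtain ⟨a, a₁, a₂, he⟩ := hrep (x * x)
    have ha : (a : B) ∈ J :=
      hconst x y hx hy (x * x) a a₁ a₂ (Ideal.mul_mem_left _ _ hx) he
    by_cases h2 : IsUnit (a₂ : B)
    · apply cancel _ (a₂ : B) y h2
      have e : (a₂ : B) * y = x * x - a - a₁ * x := by rw [he]; ring
      rw [e]
      refine sub_mem (sub_mem ?_ (Ideal.mem_sup_right ha)) ?_
      · exact Ideal.mem_sup_left (Ideal.mem_span_singleton'.mpr ⟨x, rfl⟩)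
      · exact Ideal.mem_sup_left (Ideal.mem_span_singleton'.mpr ⟨a₁, rfl⟩)
    · exfalso
      have ha₂ : (a₂ : B) ∈ J := hAJ' a₂ h2
      by_cases h1 : IsUnit (a₁ : B)
      · have h3 : (x - a₁) * x ∈ J := by
          have e : (x - (a₁ : B)) * x = a + a₂ * y := by linear_combination he
          rw [e]
          exact add_mem ha (J.mul_mem_right _ ha₂)
        have h4 : x ∈ J := cancel J (x - a₁) x (hunit_sub (a₁ : B) x h1 hx) h3
        exact hx2 (J.mul_mem_left x h4)
      · have ha₁ : (a₁ : B) ∈ J := hAJ' a₁ h1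
        apply hx2
        rw [he]
        exact add_mem (add_mem ha (J.mul_mem_right _ ha₁)) (J.mul_mem_right _ ha₂)
  have hgen' : ∀ b : B, ∃ a a₁ a₂ : A, b = a + a₁ * v + a₂ * u := fun b => by
    obtain ⟨a, a₁, a₂, he⟩ := hgen b
    exact ⟨a, a₂, a₁, by rw [he]; ring⟩
  -- the dichotomy `v ∈ uB + J` or `u ∈ vB + J`
  have key : v ∈ Ideal.span {u} ⊔ J ∨ u ∈ Ideal.span {v} ⊔ J := by
    by_cases hu2 : u * u ∈ J
    · by_cases hv2 : v * v ∈ J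
      · -- both squares in `J`: then `uv ∈ J`
        have huv : u * v ∈ J := by
          by_contra huv
          obtain ⟨a, a₁, a₂, he⟩ := hgen (u * v)
          have ha : (a : B) ∈ J :=
            hconst u v hu hv (u * v) a a₁ a₂ (Ideal.mul_mem_left _ _ hv) he
          have ha₂ : (a₂ : B) ∈ J := by
            by_contra h
            have h2u : IsUnit (a₂ : B) := by
              by_contra h'
              exact h (hAJ' a₂ h')
            apply huv
            apply cancel J (a₂ : B) (u * v) h2u
            have e : (a₂ : B) * (u * v) = (u * u) * v - u * a - a₁ * (u * u) := by
              linear_combination (-u) * he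
            rw [e]
            exact sub_mem (sub_mem (J.mul_mem_right _ hu2) (J.mul_mem_left _ ha))
              (J.mul_mem_left _ hu2)
          have ha₁ : (a₁ : B) ∈ J := by
            by_contra h
            have h1u : IsUnit (a₁ : B) := by
              by_contra h'
              exact h (hAJ' a₁ h')
            apply huv
            apply cancel J (a₁ : B) (u * v) h1u
            have e : (a₁ : B) * (u * v) = (v * v) * u - v * a - a₂ * (v * v) := by
              linear_combination (-v) * he
            rw [e]
            exact sub_mem (sub_mem (J.mul_mem_right _ hv2) (J.mul_mem_left _ ha))
              (J.mul_mem_left _ hv2)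
          apply huv
          rw [he]
          exact add_mem (add_mem ha (J.mul_mem_right _ ha₁)) (J.mul_mem_right _ ha₂)
        -- `ū, v̄` lie in the socle
        have hsu : ∀ c ∈ maximalIdeal B, c * u ∈ J := by
          intro c hc
          obtain ⟨a', b₁, b₂, hc'⟩ := hgen c
          have ha' : (a' : B) ∈ J := hconst u v hu hv c a' b₁ b₂ hc hc'
          have e : c * u = a' * u + b₁ * (u * u) + b₂ * (u * v) := by rw [hc']; ring
          rw [e]
          exact add_mem (add_mem (J.mul_mem_right _ ha') (J.mul_mem_left _ hu2))
            (J.mul_mem_left _ huv)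
        have hsv : ∀ c ∈ maximalIdeal B, c * v ∈ J := by
          intro c hc
          obtain ⟨a', b₁, b₂, hc'⟩ := hgen c
          have ha' : (a' : B) ∈ J := hconst u v hu hv c a' b₁ b₂ hc hc'
          have e : c * v = a' * v + b₁ * (u * v) + b₂ * (v * v) := by rw [hc']; ring
          rw [e]
          exact add_mem (add_mem (J.mul_mem_right _ ha') (J.mul_mem_left _ huv))
            (J.mul_mem_left _ hv2)
        obtain ⟨c₁, c₂, hc, hrel⟩ := hsoc u v hsu hsv
        rcases hc with hc₁ | hc₂
        · right
          apply cancel _ c₁ u (hunit c₁ hc₁)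
          have e : c₁ * u = (c₁ * u + c₂ * v) - c₂ * v := by ring
          rw [e]
          exact sub_mem (Ideal.mem_sup_right hrel)
            (Ideal.mem_sup_left (Ideal.mem_span_singleton'.mpr ⟨c₂, rfl⟩))
        · left
          apply cancel _ c₂ v (hunit c₂ hc₂)
          have e : c₂ * v = (c₁ * u + c₂ * v) - c₁ * u := by ring
          rw [e]
          exact sub_mem (Ideal.mem_sup_right hrel)
            (Ideal.mem_sup_left (Ideal.mem_span_singleton'.mpr ⟨c₁, rfl⟩))
      · exact Or.inr (sq_case v u hv hu hgen' hv2)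
    · exact Or.inl (sq_case u v hu hv hgen hu2)
  -- conclusion
  have finish : ∀ x y : B, (∀ b : B, ∃ a a₁ a₂ : A, b = a + a₁ * x + a₂ * y) →
      x ∈ maximalIdeal B → y ∈ maximalIdeal B →
      y ∈ Ideal.span {x} ⊔ J → maximalIdeal B ≤ Ideal.span {x} ⊔ J := by
    intro x y hrep hx hy hyx b hb
    obtain ⟨a, a₁, a₂, he⟩ := hrep b
    have ha : (a : B) ∈ J := hconst x y hx hy b a a₁ a₂ hb he
    rw [he]
    exact add_mem (add_mem (Ideal.mem_sup_right ha)
      (Ideal.mem_sup_left (Ideal.mem_span_singleton'.mpr ⟨a₁, rfl⟩))) (Ideal.mul_mem_left _ _ hyx)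
  rcases key with h | h
  · exact ⟨u, Or.inl rfl, finish u v hgen hu hv h⟩
  · exact ⟨v, Or.inr rfl, finish v u hgen' hv hu h⟩

/-- **Two socle elements are dependent** when the socle `(0 : 𝔪_B)` of `B ⧸ J` is a line: for
`s, t` with `𝔪_B s, 𝔪_B t ⊆ J` there are `c₁, c₂`, not both in `𝔪_B`, with `c₁ s + c₂ t ∈ J`.
[folklore] -/
theorem kl_socle_pair_dependent (J : Ideal B)
    (h1 : Module.finrank (B ⧸ maximalIdeal B)
      (torsionBySet B (B ⧸ (J • ⊤ : Submodule B B)) (maximalIdeal B : Set B)) = 1)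
    (s t : B) (hs : ∀ c ∈ maximalIdeal B, c * s ∈ J) (ht : ∀ c ∈ maximalIdeal B, c * t ∈ J) :
    ∃ c₁ c₂ : B, (c₁ ∉ maximalIdeal B ∨ c₂ ∉ maximalIdeal B) ∧ c₁ * s + c₂ * t ∈ J := by
  classical
  letI : Field (B ⧸ maximalIdeal B) := Ideal.Quotient.field _
  have hJ : (J • ⊤ : Submodule B B) = J := by rw [smul_eq_mul, Ideal.mul_top]
  have mem_soc : ∀ x : B, (∀ c ∈ maximalIdeal B, c * x ∈ J) →
      (Submodule.Quotient.mk x : B ⧸ (J • ⊤ : Submodule B B)) ∈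
        torsionBySet B (B ⧸ (J • ⊤ : Submodule B B)) (maximalIdeal B : Set B) := by
    intro x hx
    rw [mem_torsionBySet_iff]
    rintro ⟨c, hc⟩
    show c • (Submodule.Quotient.mk x : B ⧸ (J • ⊤ : Submodule B B)) = 0
    rw [← Submodule.Quotient.mk_smul, Submodule.Quotient.mk_eq_zero, hJ, smul_eq_mul]
    exact hx c hc
  haveI : Module.Finite (B ⧸ maximalIdeal B)
      (torsionBySet B (B ⧸ (J • ⊤ : Submodule B B)) (maximalIdeal B : Set B)) :=
    Module.finite_of_finrank_pos (by rw [h1]; exact one_pos)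
  let f : Fin 2 → torsionBySet B (B ⧸ (J • ⊤ : Submodule B B)) (maximalIdeal B : Set B) :=
    ![⟨_, mem_soc s hs⟩, ⟨_, mem_soc t ht⟩]
  have hnot : ¬ LinearIndependent (B ⧸ maximalIdeal B) f := by
    intro hli
    have := hli.fintype_card_le_finrank
    rw [h1, Fintype.card_fin] at this
    omega
  obtain ⟨g, hg, i, hi⟩ := Fintype.not_linearIndependent_iff.mp hnot
  obtain ⟨c₁, hc₁⟩ := Ideal.Quotient.mk_surjective (g 0)
  obtain ⟨c₂, hc₂⟩ := Ideal.Quotient.mk_surjective (g 1)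
  refine ⟨c₁, c₂, ?_, ?_⟩
  · by_contra hboth
    push Not at hboth
    have h0 : g 0 = 0 := by rw [← hc₁]; exact Ideal.Quotient.eq_zero_iff_mem.mpr hboth.1
    have h1' : g 1 = 0 := by rw [← hc₂]; exact Ideal.Quotient.eq_zero_iff_mem.mpr hboth.2
    rcases (Fin.exists_fin_two (p := fun j => g j ≠ 0)).mp ⟨i, hi⟩ with h | h
    · exact h h0
    · exact h h1'
  · rw [Fin.sum_univ_two, ← hc₁, ← hc₂, torsionBySet.mk_smul, torsionBySet.mk_smul] at hg
    have hg' : c₁ • (Submodule.Quotient.mk s : B ⧸ (J • ⊤ : Submodule B B)) +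
        c₂ • Submodule.Quotient.mk t = 0 := congrArg Subtype.val hg
    rw [← Submodule.Quotient.mk_smul, ← Submodule.Quotient.mk_smul, ← Submodule.Quotient.mk_add,
      Submodule.Quotient.mk_eq_zero, hJ] at hg'
    simpa only [smul_eq_mul] using hg'

/-- **Unit trick**: an `A`-basis of size `3` of the local ring `B` over the fixed ring `A = B^σ`,
with `k_A = k_B`, yields `u, v ∈ 𝔪_B` with `B = A + Au + Av`. [folklore; KiralyLutkebohmert2013 §3] -/
theorem kl_exists_two_generators_of_basis_three (σ : B ≃+* B)
    (hres : ∀ b : B, ∃ a : B, σ a = a ∧ b - a ∈ maximalIdeal B)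
    (bs : Module.Basis (Fin 3) ((σ : B →+* B).eqLocus (RingHom.id B)) B) :
    ∃ u v : B, u ∈ maximalIdeal B ∧ v ∈ maximalIdeal B ∧
      ∀ b : B, ∃ a a₁ a₂ : (σ : B →+* B).eqLocus (RingHom.id B), b = a + a₁ * u + a₂ * v := by
  classical
  set A : Subring B := (σ : B →+* B).eqLocus (RingHom.id B) with hA_def
  have hrep : ∀ b : B, ∃ c₀ c₁ c₂ : A, b = c₀ * bs 0 + c₁ * bs 1 + c₂ * bs 2 := by
    intro b
    refine ⟨bs.repr b 0, bs.repr b 1, bs.repr b 2, ?_⟩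
    conv_lhs => rw [← bs.sum_repr b]
    simp only [Fin.sum_univ_three, Subring.smul_def, smul_eq_mul]
  -- generic step: if the coefficient of `e₀` in `1` is a unit, drop `e₀`
  have step : ∀ e₀ e₁ e₂ : B, (∀ b : B, ∃ c₀ c₁ c₂ : A, b = c₀ * e₀ + c₁ * e₁ + c₂ * e₂) →
      ∀ c₀ c₁ c₂ : A, (1 : B) = c₀ * e₀ + c₁ * e₁ + c₂ * e₂ → IsUnit ((c₀ : B) * e₀) →
      ∀ b : B, ∃ a a₁ a₂ : A, b = a + a₁ * e₁ + a₂ * e₂ := by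
    intro e₀ e₁ e₂ hrep3 c₀ c₁ c₂ h1 hu b
    have hc₀ : IsUnit c₀ := isUnit_invariants_of_isUnit σ (isUnit_of_mul_isUnit_left hu)
    obtain ⟨w, hw⟩ := hc₀.exists_left_inv
    have hw' : (w : B) * c₀ = 1 := by
      have := congrArg Subtype.val hw
      simpa using this
    have he₀ : e₀ = w * (1 - c₁ * e₁ - c₂ * e₂) := by
      have h1' : (c₀ : B) * e₀ = 1 - c₁ * e₁ - c₂ * e₂ := by linear_combination (-1 : B) * h1
      calc e₀ = ((w : B) * c₀) * e₀ := by rw [hw', one_mul]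
        _ = w * (c₀ * e₀) := by ring
        _ = w * (1 - c₁ * e₁ - c₂ * e₂) := by rw [h1']
    obtain ⟨d₀, d₁, d₂, hb⟩ := hrep3 b
    refine ⟨d₀ * w, d₁ - d₀ * w * c₁, d₂ - d₀ * w * c₂, ?_⟩
    rw [hb, he₀]
    push_cast
    ring
  obtain ⟨c₀, c₁, c₂, h1⟩ := hrep 1
  have hsome : IsUnit ((c₀ : B) * bs 0) ∨ IsUnit ((c₁ : B) * bs 1) ∨ IsUnit ((c₂ : B) * bs 2) := by
    by_contra h
    push Not at h
    obtain ⟨h0, h1'', h2⟩ := h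
    have hm : (c₀ : B) * bs 0 + c₁ * bs 1 + c₂ * bs 2 ∈ maximalIdeal B :=
      add_mem (add_mem ((mem_maximalIdeal _).mpr h0) ((mem_maximalIdeal _).mpr h1''))
        ((mem_maximalIdeal _).mpr h2)
    rw [← h1] at hm
    exact (maximalIdeal.isMaximal B).ne_top (Ideal.eq_top_of_isUnit_mem _ hm isUnit_one)
  have main : ∃ e₁ e₂ : B, ∀ b : B, ∃ a a₁ a₂ : A, b = a + a₁ * e₁ + a₂ * e₂ := by
    rcases hsome with h | h | h
    · exact ⟨bs 1, bs 2, step (bs 0) (bs 1) (bs 2) hrep c₀ c₁ c₂ h1 h⟩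
    · refine ⟨bs 0, bs 2, step (bs 1) (bs 0) (bs 2) (fun b => ?_) c₁ c₀ c₂
        (by rw [h1]; ring) h⟩
      obtain ⟨d₀, d₁, d₂, hb⟩ := hrep b
      exact ⟨d₁, d₀, d₂, by rw [hb]; ring⟩
    · refine ⟨bs 0, bs 1, step (bs 2) (bs 0) (bs 1) (fun b => ?_) c₂ c₀ c₁
        (by rw [h1]; ring) h⟩
      obtain ⟨d₀, d₁, d₂, hb⟩ := hrep b
      exact ⟨d₂, d₀, d₁, by rw [hb]; ring⟩
  obtain ⟨e₁, e₂, hgen⟩ := main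
  obtain ⟨a₁', ha₁', he₁⟩ := hres e₁
  obtain ⟨a₂', ha₂', he₂⟩ := hres e₂
  refine ⟨e₁ - a₁', e₂ - a₂', he₁, he₂, fun b => ?_⟩
  obtain ⟨a, a₁, a₂, hb⟩ := hgen b
  refine ⟨a + a₁ * ⟨a₁', ha₁'⟩ + a₂ * ⟨a₂', ha₂'⟩, a₁, a₂, ?_⟩
  rw [hb]
  push_cast
  ring

end Elementary

section Main

/-- **Király–Lütkebohmert, Conjecture 9 for `p = 3`, residue-trivial case**: let `B` be a regular
local ring with a ring automorphism `σ ≠ 1`, `σ³ = 1`, `B` module-finite over the fixed ring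
`A = B^σ`, and `k_A = k_B` (`∀ b, ∃ a, σ a = a ∧ b − a ∈ 𝔪_B`). If `A` is regular then the
augmentation ideal `(σ c − c : c ∈ B)` is principal. Proof: `B` is `A`-free of rank `3`
(Bruns–Herzog 2.2.11 + Artin), `B = A + Au + Av` with `u, v ∈ 𝔪_B` (unit trick), the fibre
`B/𝔪_A B` has one-dimensional socle (`kl_finrank_socle_fiber_eq_one`), whence `𝔪_B = wB + 𝔪_A B`
(`kl_exists_gen_le_span_sup_of_socle`): `σ` is a pseudoreflection and Thm. 2 (e) ⇒ (a) applies.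
[cite: KiralyLutkebohmert2013, §3 Conjecture 9 (case p = 3, sub-case k_A = k_B), pp. 70–71] -/
theorem kl_conjecture9_three_of_residue {B : Type u} [CommRing B] [IsRegularLocalRing B]
    (σ : B ≃+* B) (hσ3 : σ ^ 3 = 1) (hσ1 : σ ≠ 1)
    [IsRegularLocalRing ((σ : B →+* B).eqLocus (RingHom.id B))]
    [Module.Finite ((σ : B →+* B).eqLocus (RingHom.id B)) B]
    (hres : ∀ b : B, ∃ a : B, σ a = a ∧ b - a ∈ maximalIdeal B) :
    (Ideal.span (Set.range fun c : B => σ c - c)).IsPrincipal := by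
  classical
  haveI : IsDomain B := isDomain_of_isRegularLocalRing B
  haveI : Module.Free ((σ : B →+* B).eqLocus (RingHom.id B)) B :=
    kl_free_of_isRegularLocalRing_fixed σ
  obtain ⟨bs⟩ := kl_nonempty_basis_fin_of_free Nat.prime_three σ hσ3 hσ1
  obtain ⟨u, v, hu, hv, hgen⟩ := kl_exists_two_generators_of_basis_three σ hres bs
  obtain ⟨as, hasreg, hasm, -⟩ :=
    exists_isRegular_ofList_eq_maximalIdeal (R := (σ : B →+* B).eqLocus (RingHom.id B))
  have h1 := kl_finrank_socle_fiber_eq_one ((σ : B →+* B).eqLocus (RingHom.id B)) as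
    hasreg.toIsWeaklyRegular hasm
  set J : Ideal B :=
    Ideal.ofList (as.map (algebraMap ((σ : B →+* B).eqLocus (RingHom.id B)) B)) with hJ_def
  have hJmap : J = Ideal.map (algebraMap ((σ : B →+* B).eqLocus (RingHom.id B)) B)
      (maximalIdeal ((σ : B →+* B).eqLocus (RingHom.id B))) := by
    rw [hJ_def, ← Ideal.map_ofList, hasm]
  have hAJ : ∀ a : (σ : B →+* B).eqLocus (RingHom.id B),
      (a : B) ∈ maximalIdeal B → (a : B) ∈ J := by
    intro a ha
    have ha' := (kl_mem_maximalIdeal_fixed_iff σ a).mpr ha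
    rw [hJmap]
    exact Ideal.mem_map_of_mem _ ha'
  have hsoc := fun s t hs ht => kl_socle_pair_dependent J h1 s t hs ht
  obtain ⟨w, hw, hle⟩ :=
    kl_exists_gen_le_span_sup_of_socle ((σ : B →+* B).eqLocus (RingHom.id B)) J hAJ u v hu hv
      hgen hsoc
  have hwm : w ∈ maximalIdeal B := by
    rcases hw with rfl | rfl
    · exact hu
    · exact hv
  set S : Set B :=
    {r : B | r ∈ as.map (algebraMap ((σ : B →+* B).eqLocus (RingHom.id B)) B)} with hS_def
  have hSfix : ∀ r ∈ S, σ r = r := by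
    intro r hr
    obtain ⟨a, -, rfl⟩ := List.mem_map.mp hr
    exact a.2
  have hSm : ∀ r ∈ S, r ∈ maximalIdeal B := by
    intro r hr
    obtain ⟨a, ha, rfl⟩ := List.mem_map.mp hr
    have : a ∈ maximalIdeal ((σ : B →+* B).eqLocus (RingHom.id B)) :=
      hasm ▸ Ideal.subset_span ha
    exact (kl_mem_maximalIdeal_fixed_iff σ a).mp this
  have hgen' : Ideal.span (insert w S) = maximalIdeal B := by
    apply le_antisymm
    · rw [Ideal.span_le]
      intro r hr
      rcases Set.mem_insert_iff.mp hr with rfl | hr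
      · exact hwm
      · exact hSm r hr
    · rw [Ideal.span_insert]
      exact hle
  exact ⟨⟨σ w - w, kl_augIdeal_eq_span_singleton_of_pseudoreflection σ hres w hSfix hgen'⟩⟩

end Main

end Summit.ResolutionOfSingularities.ResolutionOfSingularities.Theorems
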